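import Summits.HodgeConjecture.HodgeConjecture.Theorems.R90S2ArchLocalCuspidalDefs     -- S2-R13 Defs (cand v2 = v1 cafd305cd4ccf4b3 + `locFrame` carrier token; NOT YET ★ — by-paste until filed): `IsArchFactoredAt`, `IsLocCuspidal`, `IsCuspidalAt`, `IsDSOrthogonalAt`, `ccTransport`, `locFrame`
import Summits.HodgeConjecture.HodgeConjecture.Theorems.R90S2EllipticMatConj            -- ★ p862685 (R-c): `isRegNonEllipticMat_of_isConj_archLocal`
import HarnessLib

/-!
# R90-TF ∕ S2 «Ch11-arch» — LEMMAS `R90S2ArchLocalCuspidalLemmas` (S2-R13 sibling, dealer HANDOFF-S2.g7 step (3) ∕ HEADS-S2-R13-PRE P3 P4 D6, audit J-a J-b F-C7):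
the FIRST LEMMAS over the local-at-τ binders of `R90S2ArchLocalCuspidalDefs` — cand v1, HOME PRE-TYPE (NOT filed; GREEN by paste over the Defs cand)

Cell `pub/hodgecm-mathlib`, HCML Track R90-TF, section S2 (base `R90-C11`), typist `R90-C11-typ1` (g3); crux h413 = `stmt-HodgeConjecture-24833`, route of record
`HCCMUnconditional`.  Successor work named in S2 dealer K2E1b-plan (g7) HANDOFF-S2.g7 (23:09Z) step (3) «sibling `R90S2ArchLocalCuspidalLemmas` (pair lemma F-C7,
O-rep ⇒ O-cls bridge under hinv, `IsOrbitalProductAt` tie)» and in the typ1 (g2) HEADS sheet (P3 representative independence, P4, D6) + R90-C11-audit1 (g0) successor notes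
J-a (payment at `x = x₀` from a pseudo-coefficient needs the `x₀`-instance of DS-class invariance as a NAMED hypothesis) and J-b (`fτ := ccTransport e.symm φ` + round trip).
THEOREMS with real proofs + one small `def` (`IsArchFactoredAtPair`); NO socket, NO instance, NO notation, NO `sorry`, default heartbeats.

## CONTENTS
* §1 TRANSPORT ALGEBRA (J-b): `ccTransport_symm_ccTransport`, `ccTransport_ccTransport_symm` (round trips), `ccTransport_zero`, `ccTransport_add`, `ccTransport_smul`;
  `isLocDSOrthogonal_ccTransport_symm_iff` — for a test function `φ` ON THE E1b CARRIER, `IsLocDSOrthogonal … (ccTransport (locFrame …).toHomeomorph.symm φ)` is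
  LITERALLY the E1b-currency statement about `φ` (no frame left in it); `isLocDSOrthogonal_ccTransport_symm_of_pseudoCoefficient` (J-a): the conclusion shape of the
  open E1b socket U8-7 `sig_K2E1bPseudoCoefficientDS` at a class `x₀` («trace `0` on every tempered unitary globalization of every class `x ≠ x₀`») TOGETHER WITH the
  `x₀`-instance of DS-class invariance («every unitary globalization of `x₀` is discrete series», hypothesis `hx₀` — E1b's `DSClassInvarianceStmt` at `x₀`, carried
  by name, never proved here) PAYS `IsLocDSOrthogonal` for the pulled-back local component; `isDSOrthogonalAt_of_isArchFactoredAt_ccTransport_symm` assembles the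
  binder `IsDSOrthogonalAt`.
* §2 REPRESENTATIVE INDEPENDENCE (P3, over ★ p862685): `isRegNonEllipticMat_out_mk` and `isLocCuspidal_iff_forall_mk` — `IsLocCuspidal` read on `ConjClasses.mk γ`
  with the regularity hypothesis on `γ` itself (no `Quotient.out`).
* §3 JOINT TWO-PLACE FACTORIZATION (F-C7): `IsArchFactoredAtPair ι H τ₁ τ₂ f fτ₁ fτ₂ fcc` («`f = fτ₁ ⊗ fτ₂ ⊗ f^{τ₁τ₂}`»), its two one-place shadows
  (`.isArchFactoredAt_left`, `.isArchFactoredAt_right`), the abstract product lemma `exists_pair_factor_of_factor` (a function on a dependent product that factors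
  at index `i` AND at index `j ≠ i` factors at the pair, KEEPING both named components), `IsArchFactoredAt.pair`, and the consumer corollaries
  `IsCuspidalAt.pair_isCuspidalAt` (any `N`) and `IsCuspidalAt.pair_isDSOrthogonalAt` (`N = 3`): from «cuspidal at `τ₁`» and «DS-orthogonal at `τ₂`», `τ₁ ≠ τ₂`, ONE
  joint factorization whose `τ₁`-component is locally cuspidal and whose `τ₂`-component is locally DS-orthogonal — the form Arthur's splitting step consumes (S7 (T)₂).
* §4 (the local ⊗ away PRODUCT TIE `IsOrbitalProductAt` + architecture (B) corollary) lives in the second sibling `R90S2ArchOrbitalProductTie` (400-line split).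
* NOT HERE: the (O-rep) ⇒ (O-cls) bridge `isLocDSOrthogonalCls_of_isLocDSOrthogonal` (needs the ED. 2 names `DSClassInvarianceStmt`∕`TemperedClassInvarianceStmt` of
  ★ `R90S2TemperedDSClassDefs`, probe v3 bb49b098b3a09fce, not yet filed — additions-only later); sockets (Lines business, ∃-form per F-C6).

HONEST LABEL: lemmas about binders; no test function is PROVED cuspidal or DS-orthogonal anywhere in the tree (E1∕E1b∕E4 content); HC_CM is proved only modulo the
7 printed citations (2 remaining named inputs: hLiu418 = stmt-HodgeConjecture-24832, h413 = stmt-HodgeConjecture-24833) until rung 0 closes.  Count-neutral.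

References: [Arthur1988InvariantTraceFormulaII] §7 (cuspidal functions at two places; splitting); [Rogawski1990] §14.4 (pseudo-coefficients, simple trace formula),
§14.5 p. 240 («… vanish if G′_v = G_v because there exists a place w ≠ v such that G′_w ≠ G_w and Φ^M(γ, f_w) = 0» — the two-place move §3 serves; audit A1
23:30:00Z), Thm. 14.6.1 (proof, p. 240: «the traces of f and f′^H are zero on all principal series representations» = (O-rep)), §3.1 p. 19 (regular ∕ elliptic
elements, conjugacy classes); [ClozelDelorme1990] Prop. 4, Corollaire; [ClozelDelorme1984] Thm. 1; [BorelJacquet1979] §4.1 (local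
components of a factorizable function); [Knapp1986] Thm. 10.2.
-/

set_option autoImplicit false
set_option linter.dupNamespace false

noncomputable section

open MeasureTheory NumberField NumberField.InfinitePlace CompactlySupported
open scoped Matrix MatrixGroups InnerProductSpace ComplexOrder
open Literature.NumberTheory.Automorphic Literature.NumberTheory.Automorphic.UnitaryGroup
open Literature.RepresentationTheory.KonnoKonno2007 Literature.RepresentationTheory.KonnoKonno2007.RealDualPair
open Summit.HodgeConjecture.HodgeConjecture.Cruxes.H413.K2E1bGKCohomologyU21.U8 (IsDiscreteSeriesRep IsTemperedRep HasArchOpTrace)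

namespace Summit.HodgeConjecture.HodgeConjecture.R90.S2

/-! ## §1 Transport algebra along a homeomorphism (J-b) and the pseudo-coefficient payment form (J-a) -/

section Transport

variable {X Y : Type*} [TopologicalSpace X] [TopologicalSpace Y] (e : X ≃ₜ Y)

/-- Round trip: transporting along `e` and back along `e.symm` is the identity. [folklore] -/
theorem ccTransport_symm_ccTransport (f : C_c(X, ℂ)) : ccTransport e.symm (ccTransport e f) = f := by
  ext x
  simp [ccTransport_apply]

/-- Round trip: transporting along `e.symm` and then along `e` is the identity (the J-b form: `fτ := ccTransport e.symm φ` has transport `φ`). [folklore] -/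
theorem ccTransport_ccTransport_symm (φ : C_c(Y, ℂ)) : ccTransport e (ccTransport e.symm φ) = φ := by
  ext y
  simp [ccTransport_apply]

/-- Transport of the zero test function. [folklore] -/
theorem ccTransport_zero : ccTransport e (0 : C_c(X, ℂ)) = 0 := by
  ext y
  simp [ccTransport_apply]

/-- Transport is additive. [folklore] -/
theorem ccTransport_add (f g : C_c(X, ℂ)) : ccTransport e (f + g) = ccTransport e f + ccTransport e g := by
  ext y
  simp [ccTransport_apply]

/-- Transport commutes with scalars. [folklore] -/
theorem ccTransport_smul (c : ℂ) (f : C_c(X, ℂ)) : ccTransport e (c • f) = c • ccTransport e f := by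
  ext y
  simp [ccTransport_apply]

end Transport

section TransportDS

variable {L : Type} [Field L] [NumberField L] [IsCMField L] (H : Matrix (Fin 3) (Fin 3) L) (τc : {w : InfinitePlace L // w.IsComplex})
  (T : GL (Fin 3) ℂ)
  (hT : (T : Matrix (Fin 3) (Fin 3) ℂ)ᴴ * H.map τc.1.embedding * (T : Matrix (Fin 3) (Fin 3) ℂ) =
    Literature.Geometry.ComplexHyperbolic.BallModel.J)

omit [NumberField L] [IsCMField L] in
/-- **(J-b) For a test function `φ` ON THE E1b CARRIER `U(2,1)`, local DS-orthogonality of its pull-back `ccTransport (locFrame …).toHomeomorph.symm φ` to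
`U(σ_τc H)(ℂ)` is LITERALLY the E1b-currency statement about `φ`** (the frame cancels by the round trip). [cite: ClozelDelorme1990, Prop. 4, Corollaire]
[cite: Rogawski1990, §14.4] -/
theorem isLocDSOrthogonal_ccTransport_symm_iff
    [MeasurableSpace ↥(uFormGroup (Fin 2) (Fin 1)).carrier] [BorelSpace ↥(uFormGroup (Fin 2) (Fin 1)).carrier]
    (ν : Measure ↥(uFormGroup (Fin 2) (Fin 1)).carrier) [IsFiniteMeasureOnCompacts ν]
    (φ : C_c(↥(uFormGroup (Fin 2) (Fin 1)).carrier, ℂ)) :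
    IsLocDSOrthogonal H τc T hT ν (ccTransport (locFrame H τc T hT).toHomeomorph.symm φ) ↔
      ∀ (x : GKIrrClass (uFormGroup (Fin 2) (Fin 1)))
        (E : Type) [NormedAddCommGroup E] [InnerProductSpace ℂ E] [CompleteSpace E]
        (ϖ : ContRepresentation ℂ ↥(uFormGroup (Fin 2) (Fin 1)).carrier E) (hϖ : IsUnitaryGlobalization (uFormGroup (Fin 2) (Fin 1)) x ϖ),
        IsTemperedRep (uFormGroup (Fin 2) (Fin 1)) ν ϖ → ¬ IsDiscreteSeriesRep (uFormGroup (Fin 2) (Fin 1)) ν ϖ →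
          HasArchOpTrace ν ϖ hϖ.isUnitary hϖ.isStronglyContinuous φ 0 := by
  rw [isLocDSOrthogonal_iff, ccTransport_ccTransport_symm]

omit [NumberField L] [IsCMField L] in
/-- **(J-a) THE PSEUDO-COEFFICIENT PAYMENT FORM.**  The conclusion shape of the open E1b socket U8-7 `sig_K2E1bPseudoCoefficientDS` at a class `x₀` — «`φ` has
trace `0` on every TEMPERED unitary globalization of every class `x ≠ x₀`» (`hφ`) — together with the `x₀`-INSTANCE OF DS-CLASS INVARIANCE «every unitary
globalization of `x₀` is discrete series» (`hx₀`: E1b's class-invariance road, a NAMED hypothesis here, never proved in S2) pays local DS-orthogonality of the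
pulled-back component: at `x ≠ x₀` by `hφ`, at `x = x₀` vacuously (a tempered NON-discrete-series globalization of `x₀` contradicts `hx₀`).
[cite: ClozelDelorme1984, Thm. 1] [cite: ClozelDelorme1990, Prop. 4, Corollaire] [cite: Rogawski1990, §14.4] [cite: Rogawski1990, Thm. 14.6.1 (proof, p. 241)] -/
theorem isLocDSOrthogonal_ccTransport_symm_of_pseudoCoefficient
    [MeasurableSpace ↥(uFormGroup (Fin 2) (Fin 1)).carrier] [BorelSpace ↥(uFormGroup (Fin 2) (Fin 1)).carrier]
    (ν : Measure ↥(uFormGroup (Fin 2) (Fin 1)).carrier) [IsFiniteMeasureOnCompacts ν]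
    (x₀ : GKIrrClass (uFormGroup (Fin 2) (Fin 1))) (φ : C_c(↥(uFormGroup (Fin 2) (Fin 1)).carrier, ℂ))
    (hx₀ : ∀ (E : Type) [NormedAddCommGroup E] [InnerProductSpace ℂ E] [CompleteSpace E]
      (ϖ : ContRepresentation ℂ ↥(uFormGroup (Fin 2) (Fin 1)).carrier E),
      IsUnitaryGlobalization (uFormGroup (Fin 2) (Fin 1)) x₀ ϖ → IsDiscreteSeriesRep (uFormGroup (Fin 2) (Fin 1)) ν ϖ)
    (hφ : ∀ (x : GKIrrClass (uFormGroup (Fin 2) (Fin 1)))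
      (E : Type) [NormedAddCommGroup E] [InnerProductSpace ℂ E] [CompleteSpace E]
      (ϖ : ContRepresentation ℂ ↥(uFormGroup (Fin 2) (Fin 1)).carrier E) (hϖ : IsUnitaryGlobalization (uFormGroup (Fin 2) (Fin 1)) x ϖ),
      x ≠ x₀ → IsTemperedRep (uFormGroup (Fin 2) (Fin 1)) ν ϖ →
        HasArchOpTrace ν ϖ hϖ.isUnitary hϖ.isStronglyContinuous φ 0) :
    IsLocDSOrthogonal H τc T hT ν (ccTransport (locFrame H τc T hT).toHomeomorph.symm φ) := by
  rw [isLocDSOrthogonal_ccTransport_symm_iff]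
  intro x E _ _ _ ϖ hϖ htemp hnds
  by_cases hx : x = x₀
  · subst hx
    exact absurd (hx₀ E ϖ hϖ) hnds
  · exact hφ x E ϖ hϖ hx htemp

/-- **Assembling the binder**: a test function on `U(H)(L ⊗ ℝ)` that factors at `τ` with `τ`-component the pull-back of a carrier test function `φ` satisfying
the E1b-currency orthogonality is DS-orthogonal at `τ`. [cite: ClozelDelorme1990, Prop. 4, Corollaire] [cite: Arthur1988InvariantTraceFormulaII, §7] -/
theorem isDSOrthogonalAt_of_isArchFactoredAt_ccTransport_symm (ι : L →+* ℂ) (τ : CptPlace L ι) (T' : GL (Fin 3) ℂ)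
    (hT' : (T' : Matrix (Fin 3) (Fin 3) ℂ)ᴴ * H.map (cptToComplex L ι τ).1.embedding * (T' : Matrix (Fin 3) (Fin 3) ℂ) =
      Literature.Geometry.ComplexHyperbolic.BallModel.J)
    [MeasurableSpace ↥(uFormGroup (Fin 2) (Fin 1)).carrier] [BorelSpace ↥(uFormGroup (Fin 2) (Fin 1)).carrier]
    (ν : Measure ↥(uFormGroup (Fin 2) (Fin 1)).carrier) [IsFiniteMeasureOnCompacts ν]
    (φ : C_c(↥(uFormGroup (Fin 2) (Fin 1)).carrier, ℂ))
    (hφ : ∀ (x : GKIrrClass (uFormGroup (Fin 2) (Fin 1)))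
      (E : Type) [NormedAddCommGroup E] [InnerProductSpace ℂ E] [CompleteSpace E]
      (ϖ : ContRepresentation ℂ ↥(uFormGroup (Fin 2) (Fin 1)).carrier E) (hϖ : IsUnitaryGlobalization (uFormGroup (Fin 2) (Fin 1)) x ϖ),
      IsTemperedRep (uFormGroup (Fin 2) (Fin 1)) ν ϖ → ¬ IsDiscreteSeriesRep (uFormGroup (Fin 2) (Fin 1)) ν ϖ →
        HasArchOpTrace ν ϖ hϖ.isUnitary hϖ.isStronglyContinuous φ 0)
    {f : ↥(arch (↥(maximalRealSubfield L)) L (IsCMField.complexConj L) 3 H) → ℂ}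
    {fc : (∀ w : {w : {w : InfinitePlace L // w.IsComplex} // w ≠ cptToComplex L ι τ}, ↥(archLocal L 3 H w.1)) → ℂ}
    (hf : IsArchFactoredAt ι H τ f (ccTransport (locFrame H (cptToComplex L ι τ) T' hT').toHomeomorph.symm φ) fc) :
    IsDSOrthogonalAt ι H τ T' hT' ν f :=
  ⟨_, fc, hf, (isLocDSOrthogonal_ccTransport_symm_iff H (cptToComplex L ι τ) T' hT' ν φ).2 hφ⟩

end TransportDS

/-! ## §2 Representative independence of `IsLocCuspidal` (P3, class-function hinge ★ p862685) -/

section LocCuspidalReps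

variable {L : Type} [Field L] [NumberField L] [IsCMField L] {N : ℕ} (H : Matrix (Fin N) (Fin N) L)
  (τc : {w : InfinitePlace L // w.IsComplex})

omit [NumberField L] [IsCMField L] in
/-- The chosen representative of the class of `γ` is regular non-elliptic iff `γ` is (★ `isRegNonEllipticMat_of_isConj_archLocal` with
`IsConj (Quotient.out (ConjClasses.mk γ)) γ`). [cite: Rogawski1990, §3.1 p. 19] -/
theorem isRegNonEllipticMat_out_mk (γ : ↥(archLocal L N H τc)) :
    IsRegNonEllipticMat (((Quotient.out (ConjClasses.mk γ) : ↥(archLocal L N H τc)) : GL (Fin N) ℂ) : Matrix (Fin N) (Fin N) ℂ) ↔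
      IsRegNonEllipticMat (((γ : ↥(archLocal L N H τc)) : GL (Fin N) ℂ) : Matrix (Fin N) (Fin N) ℂ) :=
  isRegNonEllipticMat_of_isConj_archLocal L N H τc (ConjClasses.mk_eq_mk_iff_isConj.1 (Quotient.out_eq _))

omit [NumberField L] [IsCMField L] in
/-- **`IsLocCuspidal` read on elements**: `fτ` is locally cuspidal iff its class orbital integral vanishes at `ConjClasses.mk γ` for every REGULAR NON-ELLIPTIC
`γ` — no `Quotient.out` in the hypothesis (the predicate is a class function). [cite: Arthur1988InvariantTraceFormulaII, §7] [cite: Rogawski1990, §3.1 p. 19] -/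
theorem isLocCuspidal_iff_forall_mk
    [∀ γ : ↥(archLocal L N H τc), MeasurableSpace (↥(archLocal L N H τc) ⧸ Subgroup.centralizer ({γ} : Set ↥(archLocal L N H τc)))]
    (mτ : OrbitalMeasureFamily ↥(archLocal L N H τc)) (fτ : ↥(archLocal L N H τc) → ℂ) :
    IsLocCuspidal H τc mτ fτ ↔
      ∀ γ : ↥(archLocal L N H τc), IsRegNonEllipticMat (((γ : ↥(archLocal L N H τc)) : GL (Fin N) ℂ) : Matrix (Fin N) (Fin N) ℂ) →
        classOrbitalIntegral mτ fτ (ConjClasses.mk γ) = 0 := by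
  refine ⟨fun h γ hγ => h (ConjClasses.mk γ) ((isRegNonEllipticMat_out_mk H τc γ).2 hγ), fun h c hc => ?_⟩
  have hmk : ConjClasses.mk (Quotient.out c) = c := Quotient.out_eq c
  rw [← hmk]
  exact h (Quotient.out c) hc

end LocCuspidalReps

/-! ## §3 Joint two-place factorization (F-C7) -/

section Pair

/-- **ABSTRACT PRODUCT LEMMA.**  A complex function on a dependent product `∀ k, β k` that factors at the index `i` as `a (x i) · b (x^i)` AND at the index
`j ≠ i` as `a' (x j) · b' (x^j)` factors at the PAIR as `a (x i) · a' (x j) · c (x^{ij})`, KEEPING both named components `a`, `a'` (if the function vanishes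
identically take `c := 0`; else evaluate at a point `x₀` where it does not vanish and divide by `a (x₀ i) · a' (x₀ j) ≠ 0`). [folklore] -/
theorem exists_pair_factor_of_factor {I : Type*} {β : I → Type*} {i j : I} (hij : i ≠ j) {F : (∀ k, β k) → ℂ}
    {a : β i → ℂ} {b : (∀ k : {k : I // k ≠ i}, β k.1) → ℂ} {a' : β j → ℂ} {b' : (∀ k : {k : I // k ≠ j}, β k.1) → ℂ}
    (h₁ : ∀ x, F x = a (x i) * b (fun k => x k.1)) (h₂ : ∀ x, F x = a' (x j) * b' (fun k => x k.1)) :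
    ∃ c : (∀ k : {k : I // k ≠ i ∧ k ≠ j}, β k.1) → ℂ, ∀ x, F x = a (x i) * a' (x j) * c (fun k => x k.1) := by
  classical
  by_cases hF : ∀ x, F x = 0
  · exact ⟨0, fun x => by simp [hF x]⟩
  simp only [not_forall] at hF
  obtain ⟨x₀, hx₀⟩ := hF
  have hA₀ : a (x₀ i) ≠ 0 := fun h => hx₀ (by rw [h₁, h, zero_mul])
  have hA'₀ : a' (x₀ j) ≠ 0 := fun h => hx₀ (by rw [h₂, h, zero_mul])
  refine ⟨fun u => F (fun k => if h : k ≠ i ∧ k ≠ j then u ⟨k, h⟩ else x₀ k) / (a (x₀ i) * a' (x₀ j)), fun x => ?_⟩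
  show F x = a (x i) * a' (x j) *
    (F (fun k => if h : k ≠ i ∧ k ≠ j then x k else x₀ k) / (a (x₀ i) * a' (x₀ j)))
  -- the two intermediate points: `y₁ := x` with its `i`-component replaced by `x₀ i`, and `y₁₂ := y₁` with its `j`-component replaced by `x₀ j`
  have hext : (fun k => if h : k ≠ i ∧ k ≠ j then x k else x₀ k) =
      Function.update (Function.update x i (x₀ i)) j (x₀ j) := by
    funext k
    by_cases hki : k = i
    · subst hki
      simp [Function.update_of_ne hij]
    · by_cases hkj : k = j
      · subst hkj
        simp
      · simp [hki, hkj]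
  have e₁ : F (Function.update x i (x₀ i)) = a (x₀ i) * b (fun k => x k.1) := by
    rw [h₁, Function.update_self,
      show (fun k : {k : I // k ≠ i} => Function.update x i (x₀ i) k.1) = (fun k : {k : I // k ≠ i} => x k.1) from
        funext fun k => Function.update_of_ne k.2 _ _]
  have e₂ : F (Function.update x i (x₀ i)) = a' (x j) * b' (fun k => Function.update x i (x₀ i) k.1) := by
    rw [h₂, Function.update_of_ne hij.symm]
  have e₃ : F (Function.update (Function.update x i (x₀ i)) j (x₀ j)) =
      a' (x₀ j) * b' (fun k => Function.update x i (x₀ i) k.1) := by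
    rw [h₂, Function.update_self,
      show (fun k : {k : I // k ≠ j} => Function.update (Function.update x i (x₀ i)) j (x₀ j) k.1) =
          (fun k : {k : I // k ≠ j} => Function.update x i (x₀ i) k.1) from
        funext fun k => Function.update_of_ne k.2 _ _]
  have hB : b (fun k => x k.1) = F (Function.update x i (x₀ i)) / a (x₀ i) :=
    eq_div_of_mul_eq hA₀ (by rw [e₁, mul_comm])
  have hB' : b' (fun k => Function.update x i (x₀ i) k.1) =
      F (Function.update (Function.update x i (x₀ i)) j (x₀ j)) / a' (x₀ j) :=
    eq_div_of_mul_eq hA'₀ (by rw [e₃, mul_comm])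
  rw [hext, h₁ x, hB, e₂, hB']
  ring

variable {L : Type} [Field L] [NumberField L] [IsCMField L] {N : ℕ} (ι : L →+* ℂ) (H : Matrix (Fin N) (Fin N) L)

/-- `cptToComplex` is injective (`CptPlace L ι` is a subtype of `InfinitePlace L`): distinct compact places are distinct complex places. [folklore] -/
theorem cptToComplex_injective : Function.Injective (cptToComplex L ι) := by
  intro τ₁ τ₂ h
  have h' := congrArg Subtype.val h
  rw [cptToComplex_val, cptToComplex_val] at h'
  exact Subtype.ext h'

/-- **`f` FACTORS AT THE PAIR of compact places `(τ₁, τ₂)`** as `f = fτ₁ ⊗ fτ₂ ⊗ f^{τ₁τ₂}` along ★ `archPiEquivCM` (the joint form of `IsArchFactoredAt` that Arthur's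
two-place argument consumes: ONE factorization exhibiting both local components). [cite: BorelJacquet1979, §4.1] [cite: Arthur1988InvariantTraceFormulaII, §7] -/
def IsArchFactoredAtPair (τ₁ τ₂ : CptPlace L ι) (f : ↥(arch (↥(maximalRealSubfield L)) L (IsCMField.complexConj L) N H) → ℂ)
    (fτ₁ : ↥(archLocal L N H (cptToComplex L ι τ₁)) → ℂ) (fτ₂ : ↥(archLocal L N H (cptToComplex L ι τ₂)) → ℂ)
    (fcc : (∀ w : {w : {w : InfinitePlace L // w.IsComplex} // w ≠ cptToComplex L ι τ₁ ∧ w ≠ cptToComplex L ι τ₂}, ↥(archLocal L N H w.1)) → ℂ) :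
    Prop :=
  ∀ g, f g = fτ₁ (archPiEquivCM L H (N := N) g (cptToComplex L ι τ₁)) * fτ₂ (archPiEquivCM L H (N := N) g (cptToComplex L ι τ₂)) *
    fcc (fun w => archPiEquivCM L H (N := N) g w.1)

/-- Unfolding of `IsArchFactoredAtPair` (definitional). [folklore] -/
theorem isArchFactoredAtPair_iff (τ₁ τ₂ : CptPlace L ι) (f : ↥(arch (↥(maximalRealSubfield L)) L (IsCMField.complexConj L) N H) → ℂ)
    (fτ₁ : ↥(archLocal L N H (cptToComplex L ι τ₁)) → ℂ) (fτ₂ : ↥(archLocal L N H (cptToComplex L ι τ₂)) → ℂ)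
    (fcc : (∀ w : {w : {w : InfinitePlace L // w.IsComplex} // w ≠ cptToComplex L ι τ₁ ∧ w ≠ cptToComplex L ι τ₂}, ↥(archLocal L N H w.1)) → ℂ) :
    IsArchFactoredAtPair ι H τ₁ τ₂ f fτ₁ fτ₂ fcc ↔
      ∀ g, f g = fτ₁ (archPiEquivCM L H (N := N) g (cptToComplex L ι τ₁)) * fτ₂ (archPiEquivCM L H (N := N) g (cptToComplex L ι τ₂)) *
        fcc (fun w => archPiEquivCM L H (N := N) g w.1) :=
  Iff.rfl

/-- The LEFT shadow: a pair factorization is a factorization at `τ₁` (away-function `fτ₂ ⊗ f^{τ₁τ₂}`). [cite: BorelJacquet1979, §4.1] -/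
theorem IsArchFactoredAtPair.isArchFactoredAt_left {τ₁ τ₂ : CptPlace L ι}
    {f : ↥(arch (↥(maximalRealSubfield L)) L (IsCMField.complexConj L) N H) → ℂ}
    {fτ₁ : ↥(archLocal L N H (cptToComplex L ι τ₁)) → ℂ} {fτ₂ : ↥(archLocal L N H (cptToComplex L ι τ₂)) → ℂ}
    {fcc : (∀ w : {w : {w : InfinitePlace L // w.IsComplex} // w ≠ cptToComplex L ι τ₁ ∧ w ≠ cptToComplex L ι τ₂}, ↥(archLocal L N H w.1)) → ℂ}
    (h : IsArchFactoredAtPair ι H τ₁ τ₂ f fτ₁ fτ₂ fcc) (hne : cptToComplex L ι τ₁ ≠ cptToComplex L ι τ₂) :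
    IsArchFactoredAt ι H τ₁ f fτ₁
      (fun u => fτ₂ (u ⟨cptToComplex L ι τ₂, hne.symm⟩) * fcc (fun w => u ⟨w.1, w.2.1⟩)) :=
  fun g => by simp only [h g, mul_assoc]

/-- The RIGHT shadow: a pair factorization is a factorization at `τ₂` (away-function `fτ₁ ⊗ f^{τ₁τ₂}`). [cite: BorelJacquet1979, §4.1] -/
theorem IsArchFactoredAtPair.isArchFactoredAt_right {τ₁ τ₂ : CptPlace L ι}
    {f : ↥(arch (↥(maximalRealSubfield L)) L (IsCMField.complexConj L) N H) → ℂ}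
    {fτ₁ : ↥(archLocal L N H (cptToComplex L ι τ₁)) → ℂ} {fτ₂ : ↥(archLocal L N H (cptToComplex L ι τ₂)) → ℂ}
    {fcc : (∀ w : {w : {w : InfinitePlace L // w.IsComplex} // w ≠ cptToComplex L ι τ₁ ∧ w ≠ cptToComplex L ι τ₂}, ↥(archLocal L N H w.1)) → ℂ}
    (h : IsArchFactoredAtPair ι H τ₁ τ₂ f fτ₁ fτ₂ fcc) (hne : cptToComplex L ι τ₁ ≠ cptToComplex L ι τ₂) :
    IsArchFactoredAt ι H τ₂ f fτ₂
      (fun u => fτ₁ (u ⟨cptToComplex L ι τ₁, hne⟩) * fcc (fun w => u ⟨w.1, w.2.2⟩)) :=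
  fun g => by
    simp only [h g]
    ring

/-- **`IsArchFactoredAt.pair` (F-C7)**: a test function that factors at `τ₁` with `τ₁`-component `fτ₁` AND at `τ₂ ≠ τ₁` with `τ₂`-component `fτ₂` factors at
the PAIR with the SAME two components (abstract product lemma `exists_pair_factor_of_factor` transported along ★ `archPiEquivCM`).
[cite: BorelJacquet1979, §4.1] [cite: Arthur1988InvariantTraceFormulaII, §7] -/
theorem IsArchFactoredAt.pair {τ₁ τ₂ : CptPlace L ι}
    {f : ↥(arch (↥(maximalRealSubfield L)) L (IsCMField.complexConj L) N H) → ℂ}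
    {fτ₁ : ↥(archLocal L N H (cptToComplex L ι τ₁)) → ℂ}
    {fc₁ : (∀ w : {w : {w : InfinitePlace L // w.IsComplex} // w ≠ cptToComplex L ι τ₁}, ↥(archLocal L N H w.1)) → ℂ}
    {fτ₂ : ↥(archLocal L N H (cptToComplex L ι τ₂)) → ℂ}
    {fc₂ : (∀ w : {w : {w : InfinitePlace L // w.IsComplex} // w ≠ cptToComplex L ι τ₂}, ↥(archLocal L N H w.1)) → ℂ}
    (h₁ : IsArchFactoredAt ι H τ₁ f fτ₁ fc₁) (h₂ : IsArchFactoredAt ι H τ₂ f fτ₂ fc₂) (hne : cptToComplex L ι τ₁ ≠ cptToComplex L ι τ₂) :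
    ∃ fcc : (∀ w : {w : {w : InfinitePlace L // w.IsComplex} // w ≠ cptToComplex L ι τ₁ ∧ w ≠ cptToComplex L ι τ₂}, ↥(archLocal L N H w.1)) → ℂ,
      IsArchFactoredAtPair ι H τ₁ τ₂ f fτ₁ fτ₂ fcc := by
  obtain ⟨c, hc⟩ := exists_pair_factor_of_factor hne
    (F := fun y => f ((archPiEquivCM L H (N := N)).symm y)) (a := fτ₁) (b := fc₁) (a' := fτ₂) (b' := fc₂)
    (fun y => by simpa only [ContinuousMulEquiv.apply_symm_apply] using h₁ ((archPiEquivCM L H (N := N)).symm y))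
    (fun y => by simpa only [ContinuousMulEquiv.apply_symm_apply] using h₂ ((archPiEquivCM L H (N := N)).symm y))
  refine ⟨c, fun g => ?_⟩
  simpa only [ContinuousMulEquiv.symm_apply_apply] using hc (archPiEquivCM L H (N := N) g)

/-- **CONSUMER FORM, cuspidal × cuspidal (any `N`)**: from «cuspidal at `τ₁`» and «cuspidal at `τ₂`», `τ₁ ≠ τ₂`, ONE joint factorization with BOTH components
locally cuspidal. [cite: Arthur1988InvariantTraceFormulaII, §7] [cite: Rogawski1990, §14.5 p. 240] -/
theorem IsCuspidalAt.pair_isCuspidalAt {τ₁ τ₂ : CptPlace L ι}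
    [∀ γ : ↥(archLocal L N H (cptToComplex L ι τ₁)),
      MeasurableSpace (↥(archLocal L N H (cptToComplex L ι τ₁)) ⧸ Subgroup.centralizer ({γ} : Set ↥(archLocal L N H (cptToComplex L ι τ₁))))]
    [∀ γ : ↥(archLocal L N H (cptToComplex L ι τ₂)),
      MeasurableSpace (↥(archLocal L N H (cptToComplex L ι τ₂)) ⧸ Subgroup.centralizer ({γ} : Set ↥(archLocal L N H (cptToComplex L ι τ₂))))]
    {mτ₁ : OrbitalMeasureFamily ↥(archLocal L N H (cptToComplex L ι τ₁))} {mτ₂ : OrbitalMeasureFamily ↥(archLocal L N H (cptToComplex L ι τ₂))}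
    {f : ↥(arch (↥(maximalRealSubfield L)) L (IsCMField.complexConj L) N H) → ℂ}
    (h₁ : IsCuspidalAt ι H τ₁ mτ₁ f) (h₂ : IsCuspidalAt ι H τ₂ mτ₂ f) (hne : τ₁ ≠ τ₂) :
    ∃ (fτ₁ : ↥(archLocal L N H (cptToComplex L ι τ₁)) → ℂ) (fτ₂ : ↥(archLocal L N H (cptToComplex L ι τ₂)) → ℂ)
      (fcc : (∀ w : {w : {w : InfinitePlace L // w.IsComplex} // w ≠ cptToComplex L ι τ₁ ∧ w ≠ cptToComplex L ι τ₂}, ↥(archLocal L N H w.1)) → ℂ),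
      IsArchFactoredAtPair ι H τ₁ τ₂ f fτ₁ fτ₂ fcc ∧
        IsLocCuspidal H (cptToComplex L ι τ₁) mτ₁ fτ₁ ∧ IsLocCuspidal H (cptToComplex L ι τ₂) mτ₂ fτ₂ := by
  obtain ⟨fτ₁, fc₁, hf₁, hc₁⟩ := h₁
  obtain ⟨fτ₂, fc₂, hf₂, hc₂⟩ := h₂
  obtain ⟨fcc, hfcc⟩ := hf₁.pair ι H hf₂ ((cptToComplex_injective (L := L) ι).ne hne)
  exact ⟨fτ₁, fτ₂, fcc, hfcc, hc₁, hc₂⟩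

/-- **CONSUMER FORM, cuspidal × DS-orthogonal (`N = 3`; Arthur's two-place hypothesis as S7's splitting step consumes it)**: from «cuspidal at `τ₁`» and
«DS-orthogonal at `τ₂`», `τ₁ ≠ τ₂`, ONE joint factorization whose `τ₁`-component is locally cuspidal and whose `τ₂`-component is locally DS-orthogonal.
[cite: Arthur1988InvariantTraceFormulaII, §7] [cite: Rogawski1990, §14.5 p. 240] [cite: Rogawski1990, Thm. 14.6.1 (proof, p. 241)] -/
theorem IsCuspidalAt.pair_isDSOrthogonalAt {H₃ : Matrix (Fin 3) (Fin 3) L} {τ₁ τ₂ : CptPlace L ι}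
    [∀ γ : ↥(archLocal L 3 H₃ (cptToComplex L ι τ₁)),
      MeasurableSpace (↥(archLocal L 3 H₃ (cptToComplex L ι τ₁)) ⧸ Subgroup.centralizer ({γ} : Set ↥(archLocal L 3 H₃ (cptToComplex L ι τ₁))))]
    {mτ₁ : OrbitalMeasureFamily ↥(archLocal L 3 H₃ (cptToComplex L ι τ₁))}
    {T : GL (Fin 3) ℂ}
    {hT : (T : Matrix (Fin 3) (Fin 3) ℂ)ᴴ * H₃.map (cptToComplex L ι τ₂).1.embedding * (T : Matrix (Fin 3) (Fin 3) ℂ) =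
      Literature.Geometry.ComplexHyperbolic.BallModel.J}
    [MeasurableSpace ↥(uFormGroup (Fin 2) (Fin 1)).carrier] [BorelSpace ↥(uFormGroup (Fin 2) (Fin 1)).carrier]
    {ν : Measure ↥(uFormGroup (Fin 2) (Fin 1)).carrier} [IsFiniteMeasureOnCompacts ν]
    {f : ↥(arch (↥(maximalRealSubfield L)) L (IsCMField.complexConj L) 3 H₃) → ℂ}
    (h₁ : IsCuspidalAt ι H₃ τ₁ mτ₁ f) (h₂ : IsDSOrthogonalAt ι H₃ τ₂ T hT ν f) (hne : τ₁ ≠ τ₂) :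
    ∃ (fτ₁ : ↥(archLocal L 3 H₃ (cptToComplex L ι τ₁)) → ℂ) (fτ₂ : C_c(↥(archLocal L 3 H₃ (cptToComplex L ι τ₂)), ℂ))
      (fcc : (∀ w : {w : {w : InfinitePlace L // w.IsComplex} // w ≠ cptToComplex L ι τ₁ ∧ w ≠ cptToComplex L ι τ₂}, ↥(archLocal L 3 H₃ w.1)) → ℂ),
      IsArchFactoredAtPair ι H₃ τ₁ τ₂ f fτ₁ fτ₂ fcc ∧
        IsLocCuspidal H₃ (cptToComplex L ι τ₁) mτ₁ fτ₁ ∧ IsLocDSOrthogonal H₃ (cptToComplex L ι τ₂) T hT ν fτ₂ := by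
  obtain ⟨fτ₁, fc₁, hf₁, hc₁⟩ := h₁
  obtain ⟨fτ₂, fc₂, hf₂, hc₂⟩ := h₂
  obtain ⟨fcc, hfcc⟩ := hf₁.pair ι H₃ hf₂ ((cptToComplex_injective (L := L) ι).ne hne)
  exact ⟨fτ₁, fτ₂, fcc, hfcc, hc₁, hc₂⟩

end Pair

end Summit.HodgeConjecture.HodgeConjecture.R90.S2

end
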